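import Mathlib
import HarnessLib.Audit
import Summits.PneNP.PneNP.Theorems.PstarCrossCasePEmptyGeneric

/-!
# The blind free CROSS gate, node N1: RICH private classes are contradictory at every level (O2 / E1; prover-1 g22)

FRONTIER range-avoidance ladder, rung F-N3 (`stmt-PneNP-19007`), cell `pnp-ideate`; restricted-model proof complexity — nothing here bears on `P` versus `NP`.

Corollaries of `PstarCrossCasePEmptyGeneric.false_of_three_good` by levels `(γ_p, γ_q)` of the two gate chords (`γ = gam B e`), in node N1
(`(N.erase e_q).erase e_p = ∅`), with `A = D_p ∖ D_q`, `B = D_q ∖ D_p`, `C = D_p ∩ D_q` and "private" = `PstarCrossCorner.PrivEdge`: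

* `false_of_levels_10` — levels `(1,0)` and three distinct private edges in `A`: contradiction (each pair `π, k` is avoided by one of the three, which
  switches alone; the three are the rank-six witnesses);
* `false_of_levels_01` — levels `(0,1)`, three private edges in `B`;
* `false_of_levels_11` — levels `(1,1)`, three private edges in `A` AND three in `B` (pairs `{a, b}` switch).
(Levels `(0,0)`: `false_of_levels_zero`, three private edges in `A ∪ B`.)  So node N1 is reduced to: at levels `(1,0)` at most two private edges in `A`
(symmetrically `(0,1)`/`B`), at levels `(1,1)` at most two private edges in `A` or in `B`, at levels `(0,0)` at most two private edges in `A ∪ B` — the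
planner's pinned classes — where the budget with carriers (`PstarCrossBudgetCarriers`) must finish.
-/

set_option linter.dupNamespace false -- `Summit.PneNP.PneNP.…`: summit = sub-problem name (D-0017 single-conjunct layout)

open Finset Literature.Computability.Complexity
open Summit.PneNP.PneNP.Theorems.PstarTyped (Typed)
open Summit.PneNP.PneNP.Theorems.PstarSALevel (BoundaryExpanding SimpleOverlap)
open Summit.PneNP.PneNP.Theorems.PstarChordBridge (BridgeData)
open Summit.PneNP.PneNP.Theorems.PstarChordBridgeForcing (gam)
open Summit.PneNP.PneNP.Theorems.PstarCrossData (CrossData)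
open Summit.PneNP.PneNP.Theorems.PstarCrossCorner (PrivEdge)
open Summit.PneNP.PneNP.Theorems.PstarCrossCasePEmptyW2 (Avail)
open Summit.PneNP.PneNP.Theorems.PstarCrossCasePEmptyGeneric

namespace Summit.PneNP.PneNP.Theorems.PstarCrossCasePEmptyRich

variable {n m : ℕ}

section

variable (I : LocalMap 4 n m) {r : ℕ} {B : BridgeData n m} {e_p e_q g₀ : Fin m}

/-- Among three distinct edges one avoids any two given ones. -/
private theorem exists_avoid {j₁ j₂ j₃ π k : Fin m} (h12 : j₁ ≠ j₂) (h13 : j₁ ≠ j₃) (h23 : j₂ ≠ j₃) :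
    ∃ j ∈ ({j₁, j₂, j₃} : Finset (Fin m)), j ∉ ({π, k} : Finset (Fin m)) := by
  classical
  by_contra h
  push Not at h
  have hsub : ({j₁, j₂, j₃} : Finset (Fin m)) ⊆ {π, k} := fun j hj => h j hj
  have h3 : ({j₁, j₂, j₃} : Finset (Fin m)).card = 3 := by
    rw [card_insert_of_notMem (by simp [h12, h13]), card_pair h23]
  have h2 : ({π, k} : Finset (Fin m)).card ≤ 2 := card_insert_le _ _
  have := card_le_card hsub
  omega

/-- **Levels `(1,0)`: three distinct private edges of `D_p ∖ D_q` are contradictory.** -/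
theorem false_of_levels_10 (hI : I.IsPure xorAndPred) (hT : Typed I) (hS : SimpleOverlap I) (hB : BoundaryExpanding r I)
    (hD : CrossData I r B e_p e_q g₀) (hE : (B.N.erase e_q).erase e_p = ∅) (hp : gam B e_p = 1) (hq : gam B e_q = 0)
    {j₁ j₂ j₃ : Fin m} (h₁ : PrivEdge I B j₁) (h₂ : PrivEdge I B j₂) (h₃ : PrivEdge I B j₃) (h12 : j₁ ≠ j₂) (h13 : j₁ ≠ j₃) (h23 : j₂ ≠ j₃)
    (hA : ∀ j ∈ ({j₁, j₂, j₃} : Finset (Fin m)), j ∈ B.D e_p ∧ j ∉ B.D e_q) : False := by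
  classical
  have hpriv : ∀ j ∈ ({j₁, j₂, j₃} : Finset (Fin m)), PrivEdge I B j := by
    intro j hj; simp only [mem_insert, mem_singleton] at hj
    rcases hj with rfl | rfl | rfl <;> assumption
  refine false_of_three_good I hI hT hS hB hD hE (fun π _ k _ => ?_) h₁ h₂ h₃ h12 h13 h23 (fun j hj => Or.inl (hA j hj))
  obtain ⟨j, hj, hjX⟩ := exists_avoid (π := π) (k := k) h12 h13 h23
  exact avail_of_A I hp hq (hpriv j hj) (hA j hj).1 (hA j hj).2 hjX

/-- **Levels `(0,1)`: three distinct private edges of `D_q ∖ D_p` are contradictory.** -/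
theorem false_of_levels_01 (hI : I.IsPure xorAndPred) (hT : Typed I) (hS : SimpleOverlap I) (hB : BoundaryExpanding r I)
    (hD : CrossData I r B e_p e_q g₀) (hE : (B.N.erase e_q).erase e_p = ∅) (hp : gam B e_p = 0) (hq : gam B e_q = 1)
    {j₁ j₂ j₃ : Fin m} (h₁ : PrivEdge I B j₁) (h₂ : PrivEdge I B j₂) (h₃ : PrivEdge I B j₃) (h12 : j₁ ≠ j₂) (h13 : j₁ ≠ j₃) (h23 : j₂ ≠ j₃)
    (hBc : ∀ j ∈ ({j₁, j₂, j₃} : Finset (Fin m)), j ∉ B.D e_p ∧ j ∈ B.D e_q) : False := by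
  classical
  have hpriv : ∀ j ∈ ({j₁, j₂, j₃} : Finset (Fin m)), PrivEdge I B j := by
    intro j hj; simp only [mem_insert, mem_singleton] at hj
    rcases hj with rfl | rfl | rfl <;> assumption
  refine false_of_three_good I hI hT hS hB hD hE (fun π _ k _ => ?_) h₁ h₂ h₃ h12 h13 h23 (fun j hj => Or.inr (hBc j hj))
  obtain ⟨j, hj, hjX⟩ := exists_avoid (π := π) (k := k) h12 h13 h23
  exact avail_of_B I hp hq (hpriv j hj) (hBc j hj).1 (hBc j hj).2 hjX

/-- **Levels `(1,1)`: three distinct private edges of `D_p ∖ D_q` and three of `D_q ∖ D_p` are contradictory.** -/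
theorem false_of_levels_11 (hI : I.IsPure xorAndPred) (hT : Typed I) (hS : SimpleOverlap I) (hB : BoundaryExpanding r I)
    (hD : CrossData I r B e_p e_q g₀) (hE : (B.N.erase e_q).erase e_p = ∅) (hp : gam B e_p = 1) (hq : gam B e_q = 1)
    {a₁ a₂ a₃ : Fin m} (ha₁ : PrivEdge I B a₁) (ha₂ : PrivEdge I B a₂) (ha₃ : PrivEdge I B a₃) (ha12 : a₁ ≠ a₂) (ha13 : a₁ ≠ a₃) (ha23 : a₂ ≠ a₃)
    (hA : ∀ j ∈ ({a₁, a₂, a₃} : Finset (Fin m)), j ∈ B.D e_p ∧ j ∉ B.D e_q)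
    {b₁ b₂ b₃ : Fin m} (hb₁ : PrivEdge I B b₁) (hb₂ : PrivEdge I B b₂) (hb₃ : PrivEdge I B b₃) (hb12 : b₁ ≠ b₂) (hb13 : b₁ ≠ b₃) (hb23 : b₂ ≠ b₃)
    (hBc : ∀ j ∈ ({b₁, b₂, b₃} : Finset (Fin m)), j ∉ B.D e_p ∧ j ∈ B.D e_q) : False := by
  classical
  have hprivA : ∀ j ∈ ({a₁, a₂, a₃} : Finset (Fin m)), PrivEdge I B j := by
    intro j hj; simp only [mem_insert, mem_singleton] at hj
    rcases hj with rfl | rfl | rfl <;> assumption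
  have hprivB : ∀ j ∈ ({b₁, b₂, b₃} : Finset (Fin m)), PrivEdge I B j := by
    intro j hj; simp only [mem_insert, mem_singleton] at hj
    rcases hj with rfl | rfl | rfl <;> assumption
  refine false_of_three_good I hI hT hS hB hD hE (fun π _ k _ => ?_) ha₁ ha₂ ha₃ ha12 ha13 ha23 (fun j hj => Or.inl (hA j hj))
  obtain ⟨a, ha, haX⟩ := exists_avoid (π := π) (k := k) ha12 ha13 ha23
  obtain ⟨b, hb, hbX⟩ := exists_avoid (π := π) (k := k) hb12 hb13 hb23
  exact avail_of_AB I hp hq (hprivA a ha) (hprivB b hb) (hA a ha).1 (hA a ha).2 (hBc b hb).1 (hBc b hb).2 haX hbX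

end

end Summit.PneNP.PneNP.Theorems.PstarCrossCasePEmptyRich
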